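import Mathlib
import Summits.HodgeConjecture.FermatCycles.HodgeFermatTheoremLRowsB

/-!
# THEOREM L of `tables/DPRIME-THEOREM.md` §3 — the refinement at `p = 13`: (U, Z1) is impossible (`HodgeFermat/TheoremL13.lean`; HF-G21e)

Tree copy (whole module) of the module `HodgeFermat/TheoremL13.lean` of the sibling cell's standalone package
`run/shared/lean/pub/pub-hodgefermat/lean/HodgeFermat/` (267 lines, sha256 `ed8e61bfdd90d210…`), source lines 30–267 (all: the refinement of THEOREM L at `p = 13` — (U, Z1) is impossible, `row_UZ1_ge_thirteen`; the rows at 5 and 7 off 3).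
Filed by cell `pub-hfermat`, seat prover-1 gen-3, on the COORDINATOR KEEPER RULING of 2026-08-25 (gem sweep H1: take the
off-gate kernel theorem `thmFstar` through the gate) — here THEOREM F* of `tables/DPRIME-THEOREM.md` §9 IN FULL, i.e.
PROPOSITION D′(3N) and the descent (`HodgeFermat/PropDPrimeNFinal.lean`, GATE HF-G34), the last off-gate form of THEOREM F*
(its first two forms, `DecodingFinal.thmFstar` = F* at the prime levels and `ThmFstarNFinal.thmFstar` = F*(3N), landed on
2026-08-25 as `HodgeFermatThmFstar.lean` / `HodgeFermatThmFstarN.lean`, seats prover-1 gen-0 / gen-2); this file is one link of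
the import closure of `PropDPrimeNFinal.propDprime` (the sibling's KR-free chain: THEOREM L, COROLLARY M, THEOREM D6,
THEOREM U⁺, THEOREM KR6, THEOREM Z3U) on top of those landed chains.  The source module is the sibling's hub-checked module of
record (pub-hodgefermat `CERT.md` l.876, GATE HF-G21e; cell record `check/TheoremL13_standalone.lean` sha256 `ec47cadd9e5ee450…`); its declarations are copied VERBATIM.
Deviations from the source module, exhaustively: the `import` lines (tree modules `Summits.HodgeConjecture.FermatCycles.
HodgeFermat*` instead of `HodgeFermat.*`); this module docstring; none besides these.
Every other line — in particular every declaration's statement and proof — is byte-identical to the source.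
HONEST FRAMING: explicit algebraic cycles for specific Hodge classes on Fermat/Delsarte varieties; residual open instances
listed; no claim on general Hodge.  (This file is arithmetic of CM types / finite combinatorics / analytic number theory
of the sibling's KR-free programme; it claims nothing about cycles.)

The source module's docstring (TheoremL13.lean l.3–28), verbatim:

## THEOREM L of `tables/DPRIME-THEOREM.md` §3 — the refinement at `p = 13`: (U, Z1) is impossible
## (build hodge-fermat, generation 21, third addendum)

DPRIME §3, "Refinements at p = 13 and p = 11 (pattern (U, Z1), n′ = 3)", case `p = 13`.  By the generic row
`row_UZ1` a (U, Z1) coincidence at `p = 13` has `8n ≤ 26g`, `g = gcd(ȳ, n)`, whence `n = 3g` (`n` odd, `ȳ ≠ 0`);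
then `⟨t̄ȳ⟩_n ∈ {g, 2g}`, `k₁(t̄) = ⌊13⟨t̄ȳ⟩_n/n⌋ ∈ {4, 8}`, and since `13 ≡ 1 (mod 3)` the value `⟨t̄ȳ⟩_n` — hence `k₁` — is
the same at `t̄` and at `13̄⁻¹t̄`.  The fibre identity (E) for (Z1, U) (`fibre_identity_Z1U`) at a unit `t̄` with `k₁ = 4`
(resp. `8`) forces the carry of the Z1-triple to DROP (resp. RISE) by exactly one from `t̄` to `13̄⁻¹t̄` (because both
carry differences are at most one, `delta_le`); along the chain `1̄, 13̄⁻¹, 13̄⁻², 13̄⁻³` the carry would leave `{0, 1, 2}`.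
Contradiction.  (The hand proof uses non-degeneracy, carries in `{1, 2}`, and stops after two steps; without it three
steps suffice, so no non-degeneracy hypothesis appears.)

* `row_UZ1_three_g` : for every prime `p ≥ 11`, a (U, Z1) coincidence has `n = 3·gcd(y, n)` (so `3 ∣ n`);
  `row_UZ1_ge_eleven_not3`: hence (U, Z1) is impossible for `p ≥ 11` whenever `3 ∤ n` — the form used by THEOREM D6
  (`tables/KR-FREE.md` §7: "at p = 13, 11 the row gives n′ = 3, i.e. 3 | n — impossible").
* `row_UZ1_thirteen`: (U, Z1) is impossible at `p = 13` for every odd `n` with `13 ∤ n`.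
* `row_UZ1_ge_thirteen`: (U, Z1) is impossible for every prime `p ≥ 13` (with `row_UZ1_seventeen`).
* `row_Z3Z1_five_not3`, `row_Z1Z1_seven_not3`: the `3 ∤ n` readings of the `p = 5` / `p = 7` residues of
  `TheoremLRows.lean` used by THEOREM D6 (`tables/KR-FREE.md` §7): (Z3, Z1) impossible at `p = 5`; (Z1, Z1) at `p = 7` has `n/g = 5`.

With `row_Z3U`, `row_Z3Z1_seven`, `row_Z1Z1_eleven` and `row_UZ1_seventeen` of `TheoremLRows.lean` this makes the
row "p ≥ 13: (U, U) only" of THEOREM L a kernel theorem for every level.  Setting and model as in `TheoremLRows.lean`.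
Inside the package: `lake build HodgeFermat.TheoremL13`; hub check via the concatenation `check/TheoremL13_standalone.lean`
(`code/gen21/mkstandalone.py`: LemmaN + LemmaO + TheoremLRows + TheoremL13).  No `sorry`, no `native_decide`.
-/

set_option autoImplicit false

namespace HodgeFermat.KRFree.TheoremL

open HodgeFermat.KRFree.LemmaN HodgeFermat.KRFree.LemmaO

/-! ## `n = 3g` from the (U, Z1) bound for `p ≥ 11` -/

/-- from the (U,Z1) bound `p·n ≤ 2p·g + 5n` with `p ≥ 11` (so `n/g ≤ 2p/(p−5) < 4`): `n = 3·gcd(y,n)` (n odd, `y ≢ 0`) -/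
lemma three_g_of_bound (p n y : ℕ) (h11 : 11 ≤ p) (hn : 0 < n) (hodd : Odd n) (hy : ¬ n ∣ y)
    (h : p * n ≤ 2 * (p * Nat.gcd y n) + 5 * n) : n = 3 * Nat.gcd y n := by
  obtain ⟨n', z', hn'0, hn', _, _, hdn⟩ := decompose n y hn
  have h2 := two_le_quot n y hn hy
  have ho := quot_odd n y hn hodd
  rw [hdn] at h2 ho
  have hg0 : 0 < Nat.gcd y n := Nat.gcd_pos_of_pos_right _ hn
  obtain ⟨g, hg⟩ : ∃ g, Nat.gcd y n = g := ⟨_, rfl⟩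
  rw [hg] at h hn' hg0 ⊢
  rw [hn'] at h
  have h' : g * (p * n') ≤ g * (2 * p + 5 * n') := by
    calc g * (p * n') = p * (g * n') := by ring
      _ ≤ 2 * (p * g) + 5 * (g * n') := h
      _ = g * (2 * p + 5 * n') := by ring
  have hq : p * n' ≤ 2 * p + 5 * n' := Nat.le_of_mul_le_mul_left h' hg0
  have hn'3 : n' ≤ 3 := by
    by_contra h4
    have h4' : 4 ≤ n' := by omega
    have h4p : p * 4 ≤ p * n' := Nat.mul_le_mul_left p h4'
    have h11n : 11 * n' ≤ p * n' := Nat.mul_le_mul_right n' h11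
    omega
  obtain ⟨k, hk⟩ := ho
  have : n' = 3 := by omega
  rw [hn', this]; ring

/-! ## The value `⟨t̄ȳ⟩_n ∈ {g, 2g}` and its invariance under `t̄ ↦ 13̄⁻¹t̄` -/

/-- for a unit `t` and `n = 3g`, `g = gcd(y,n)`: `⟨ty⟩_n ∈ {g, 2g}` (LEMMA O) -/
lemma val_cases (n y t : ℕ) (hn : 0 < n) (hn3 : n = 3 * Nat.gcd y n) (ht : Nat.Coprime t n) :
    t * y % n = Nat.gcd y n ∨ t * y % n = 2 * Nat.gcd y n := by
  obtain ⟨s, hs, hsc, hv⟩ := lemmaO_mem n y t hn ht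
  have hg0 : 0 < Nat.gcd y n := Nat.gcd_pos_of_pos_right _ hn
  have hq : n / Nat.gcd y n = 3 := Nat.div_eq_of_eq_mul_right hg0 (by omega)
  rw [hq] at hs hsc
  interval_cases s
  · simp at hsc
  · left; rw [hv]; ring
  · right; rw [hv]; ring

/-- `13 ≡ 1 (mod 3)`: if `13·t₁ ≡ t₀ (mod n)`, `n = 3g`, and `⟨t₁y⟩_n = v ∈ {g, 2g}`, then `⟨t₀y⟩_n = v` -/
lemma val_step (n g y t₀ t₁ v : ℕ) (hn3 : n = 3 * g) (hg : 0 < g) (hvg : v = g ∨ v = 2 * g)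
    (h : 13 * t₁ ≡ t₀ [MOD n]) (hv : t₁ * y % n = v) : t₀ * y % n = v := by
  have hvn : v < n := by rcases hvg with rfl | rfl <;> omega
  have hdm := Nat.div_add_mod (t₁ * y) n
  rw [hv] at hdm
  obtain ⟨q, hq⟩ : ∃ q, t₁ * y / n = q := ⟨_, rfl⟩
  rw [hq] at hdm
  -- 13 * (t₁ * y) = v + n * K for a suitable K
  obtain ⟨K, hK⟩ : ∃ K, 13 * t₁ * y = v + n * K := by
    rcases hvg with rfl | rfl
    · refine ⟨13 * q + 4, ?_⟩
      subst hn3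
      zify at hdm ⊢
      linear_combination (-13 : ℤ) * hdm
    · refine ⟨13 * q + 8, ?_⟩
      subst hn3
      zify at hdm ⊢
      linear_combination (-13 : ℤ) * hdm
  have h1 : (13 * t₁ * y) % n = t₀ * y % n := Nat.ModEq.mul_right y h
  rw [← h1, hK, Nat.add_mul_mod_self_left]
  exact Nat.mod_eq_of_lt hvn

/-! ## One step of the chain: the identity (E) with `k₁ ∈ {4, 8}` made explicit -/

/-- the (Z1,U) fibre identity at `p = 13`, `n = 3g`, at a unit `t₀` with `13 t₁ ≡ t₀`, `⟨t₀ y⟩_n = v ∈ {g, 2g}`: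
`24v + 2c(t₀)n + 2c′(t₁)n + n = 13n + 2c(t₁)n + 2c′(t₀)n` (carries written as `rsum`) -/
lemma step13 (n g y x₂ x₃ x' y' z' t₀ t₁ v : ℕ) (hn3 : n = 3 * g) (hg : 0 < g)
    (hvg : v = g ∨ v = 2 * g) (h13n : ¬ 13 ∣ n) (hn : 0 < n)
    (hs : 13 * n ∣ 13 * y + x₂ + x₃) (hx₂ : ¬ 13 ∣ x₂) (hx₃ : ¬ 13 ∣ x₃)
    (hs' : 13 * n ∣ x' + y' + z') (hx' : ¬ 13 ∣ x') (hy' : ¬ 13 ∣ y') (hz' : ¬ 13 ∣ z')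
    (ht₀ : Nat.Coprime t₀ n) (ht₁ : 13 * t₁ ≡ t₀ [MOD n]) (hv : t₀ * y % n = v)
    (hH : SameType (13 * n) (13 * y, x₂, x₃) (x', y', z')) :
    24 * v + 2 * rsum n (13 * y, x₂, x₃) t₀ + 2 * rsum n (x', y', z') t₁ + n
      = 13 * n + 2 * rsum n (13 * y, x₂, x₃) t₁ + 2 * rsum n (x', y', z') t₀ := by
  have hp : (13).Prime := by norm_num
  have hE := fibre_identity_Z1U 13 n y x₂ x₃ x' y' z' t₀ t₁ hp h13n hn hs hx₂ hx₃ hs' hx' hy' hz' ht₀ ht₁ hH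
  rw [hv] at hE
  have hvn : v < n := by rcases hvg with rfl | rfl <;> omega
  have hk : 2 * n * (13 * v / n) = 24 * v := by
    rcases hvg with h1 | h2
    · have e : 13 * v = v + n * 4 := by rw [h1, hn3]; ring
      rw [e, Nat.add_mul_div_left _ _ hn, Nat.div_eq_of_lt hvn, h1, hn3]; ring
    · have e : 13 * v = v + n * 8 := by rw [h2, hn3]; ring
      rw [e, Nat.add_mul_div_left _ _ hn, Nat.div_eq_of_lt hvn, h2, hn3]; ring
  rw [hk] at hE
  exact hE

/-! ## The refinement at `p = 13` -/

/-- for every prime `p ≥ 11`, a (U, Z1) coincidence at `p` forces `n = 3·gcd(y, n)` — in particular `3 ∣ n`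
(the form in which `tables/KR-FREE.md` §7 uses the (U,Z1) row at `p ∈ {11, 13}`) -/
theorem row_UZ1_three_g (p n y x₂ x₃ x' y' z' : ℕ) (hp : p.Prime) (h11 : 11 ≤ p) (hpn : ¬ p ∣ n) (hn : 0 < n)
    (hodd : Odd n) (hs : p * n ∣ p * y + x₂ + x₃) (hx₂ : ¬ p ∣ x₂) (hx₃ : ¬ p ∣ x₃)
    (hs' : p * n ∣ x' + y' + z') (hx' : ¬ p ∣ x') (hy' : ¬ p ∣ y') (hz' : ¬ p ∣ z') (hy : ¬ n ∣ y)
    (hH : SameType (p * n) (p * y, x₂, x₃) (x', y', z')) : n = 3 * Nat.gcd y n := by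
  have h := row_UZ1 p n y x₂ x₃ x' y' z' hp hpn hn hs hx₂ hx₃ hs' hx' hy' hz' hy hH
  exact three_g_of_bound p n y h11 hn hodd hy h

/-- THEOREM D6's use of the row (`tables/KR-FREE.md` §7, second bullet): for every prime `p ≥ 11` and every odd `n`
with `3 ∤ n`, the pattern (U, Z1) is impossible. -/
theorem row_UZ1_ge_eleven_not3 (p n y x₂ x₃ x' y' z' : ℕ) (hp : p.Prime) (h11 : 11 ≤ p) (hpn : ¬ p ∣ n)
    (hn : 0 < n) (hodd : Odd n) (h3 : ¬ 3 ∣ n) (hs : p * n ∣ p * y + x₂ + x₃) (hx₂ : ¬ p ∣ x₂) (hx₃ : ¬ p ∣ x₃)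
    (hs' : p * n ∣ x' + y' + z') (hx' : ¬ p ∣ x') (hy' : ¬ p ∣ y') (hz' : ¬ p ∣ z') (hy : ¬ n ∣ y)
    (hH : SameType (p * n) (p * y, x₂, x₃) (x', y', z')) : False := by
  have h := row_UZ1_three_g p n y x₂ x₃ x' y' z' hp h11 hpn hn hodd hs hx₂ hx₃ hs' hx' hy' hz' hy hH
  exact h3 ⟨Nat.gcd y n, h⟩

/-- THEOREM L, refinement at `p = 13`: the pattern (U, Z1) is impossible (every odd `n` with `13 ∤ n`). -/
theorem row_UZ1_thirteen (n y x₂ x₃ x' y' z' : ℕ) (h13n : ¬ 13 ∣ n) (hn : 0 < n) (hodd : Odd n)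
    (hs : 13 * n ∣ 13 * y + x₂ + x₃) (hx₂ : ¬ 13 ∣ x₂) (hx₃ : ¬ 13 ∣ x₃)
    (hs' : 13 * n ∣ x' + y' + z') (hx' : ¬ 13 ∣ x') (hy' : ¬ 13 ∣ y') (hz' : ¬ 13 ∣ z') (hy : ¬ n ∣ y)
    (hH : SameType (13 * n) (13 * y, x₂, x₃) (x', y', z')) : False := by
  have hp : (13).Prime := by norm_num
  have hn3 := row_UZ1_three_g 13 n y x₂ x₃ x' y' z' hp (by norm_num) h13n hn hodd hs hx₂ hx₃ hs' hx' hy' hz' hy hH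
  obtain ⟨g, hg⟩ : ∃ g, Nat.gcd y n = g := ⟨_, rfl⟩
  have hg0 : 0 < g := by rw [← hg]; exact Nat.gcd_pos_of_pos_right _ hn
  -- the chain 1 ← t₁ ← t₂ ← t₃ of units with 13·t_{i+1} ≡ t_i (mod n)
  have hu₀ : Nat.Coprime 1 n := Nat.coprime_one_left n
  obtain ⟨t₁, ht₁⟩ := exists_t₁ 13 n 1 hp h13n hn
  have hu₁ := coprime_t₁ ht₁ hu₀
  obtain ⟨t₂, ht₂⟩ := exists_t₁ 13 n t₁ hp h13n hn
  have hu₂ := coprime_t₁ ht₂ hu₁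
  obtain ⟨t₃, ht₃⟩ := exists_t₁ 13 n t₂ hp h13n hn
  have hu₃ := coprime_t₁ ht₃ hu₂
  -- the common value v = ⟨t ȳ⟩_n along the chain
  obtain ⟨v, hv₂⟩ : ∃ v, t₂ * y % n = v := ⟨_, rfl⟩
  have hvg : v = g ∨ v = 2 * g := by
    rw [← hv₂, ← hg]; exact val_cases n y t₂ hn hn3 hu₂
  rw [hg] at hn3
  have hv₁ : t₁ * y % n = v := val_step n g y t₁ t₂ v hn3 hg0 hvg ht₂ hv₂
  have hv₀ : 1 * y % n = v := val_step n g y 1 t₁ v hn3 hg0 hvg ht₁ hv₁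
  -- the three identities
  have hE₀ := step13 n g y x₂ x₃ x' y' z' 1 t₁ v hn3 hg0 hvg h13n hn hs hx₂ hx₃ hs' hx' hy' hz' hu₀ ht₁ hv₀ hH
  have hE₁ := step13 n g y x₂ x₃ x' y' z' t₁ t₂ v hn3 hg0 hvg h13n hn hs hx₂ hx₃ hs' hx' hy' hz' hu₁ ht₂ hv₁ hH
  have hE₂ := step13 n g y x₂ x₃ x' y' z' t₂ t₃ v hn3 hg0 hvg h13n hn hs hx₂ hx₃ hs' hx' hy' hz' hu₂ ht₃ hv₂ hH
  -- carry bounds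
  have hsn : n ∣ 13 * y + x₂ + x₃ := dvd_of_level hs
  have hsn' : n ∣ x' + y' + z' := dvd_of_level hs'
  have hA₀ := rsum_tri n (13 * y) x₂ x₃ 1 hn hsn
  have hA₃ := rsum_tri n (13 * y) x₂ x₃ t₃ hn hsn
  have hdA₀ := delta_le n (13 * y) x₂ x₃ 1 t₁ hn hsn hu₀ hu₁
  have hdA₁ := delta_le n (13 * y) x₂ x₃ t₁ t₂ hn hsn hu₁ hu₂
  have hdA₂ := delta_le n (13 * y) x₂ x₃ t₂ t₃ hn hsn hu₂ hu₃
  have hdB₀ := delta_le n x' y' z' 1 t₁ hn hsn' hu₀ hu₁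
  have hdB₁ := delta_le n x' y' z' t₁ t₂ hn hsn' hu₁ hu₂
  have hdB₂ := delta_le n x' y' z' t₂ t₃ hn hsn' hu₂ hu₃
  -- name the atoms and close by linear arithmetic
  obtain ⟨A₀, hA0⟩ : ∃ R, rsum n (13 * y, x₂, x₃) 1 = R := ⟨_, rfl⟩
  obtain ⟨A₁, hA1⟩ : ∃ R, rsum n (13 * y, x₂, x₃) t₁ = R := ⟨_, rfl⟩
  obtain ⟨A₂, hA2⟩ : ∃ R, rsum n (13 * y, x₂, x₃) t₂ = R := ⟨_, rfl⟩
  obtain ⟨A₃, hA3⟩ : ∃ R, rsum n (13 * y, x₂, x₃) t₃ = R := ⟨_, rfl⟩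
  obtain ⟨B₀, hB0⟩ : ∃ R, rsum n (x', y', z') 1 = R := ⟨_, rfl⟩
  obtain ⟨B₁, hB1⟩ : ∃ R, rsum n (x', y', z') t₁ = R := ⟨_, rfl⟩
  obtain ⟨B₂, hB2⟩ : ∃ R, rsum n (x', y', z') t₂ = R := ⟨_, rfl⟩
  obtain ⟨B₃, hB3⟩ : ∃ R, rsum n (x', y', z') t₃ = R := ⟨_, rfl⟩
  rw [hA0, hA1, hB0, hB1] at hE₀
  rw [hA1, hA2, hB1, hB2] at hE₁
  rw [hA2, hA3, hB2, hB3] at hE₂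
  rw [hA0] at hA₀
  rw [hA3] at hA₃
  rw [hA0, hA1] at hdA₀
  rw [hA1, hA2] at hdA₁
  rw [hA2, hA3] at hdA₂
  rw [hB0, hB1] at hdB₀
  rw [hB1, hB2] at hdB₁
  rw [hB2, hB3] at hdB₂
  rcases hvg with rfl | rfl <;> omega

/-- THEOREM L, row `p ≥ 13`: the pattern (U, Z1) is impossible for EVERY prime `p ≥ 13`
(`p = 13`: `row_UZ1_thirteen`; `p ≥ 17`: `row_UZ1_seventeen`; there is no prime in between). -/
theorem row_UZ1_ge_thirteen (p n y x₂ x₃ x' y' z' : ℕ) (hp : p.Prime) (h13 : 13 ≤ p) (hpn : ¬ p ∣ n)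
    (hn : 0 < n) (hodd : Odd n) (hs : p * n ∣ p * y + x₂ + x₃) (hx₂ : ¬ p ∣ x₂) (hx₃ : ¬ p ∣ x₃)
    (hs' : p * n ∣ x' + y' + z') (hx' : ¬ p ∣ x') (hy' : ¬ p ∣ y') (hz' : ¬ p ∣ z') (hy : ¬ n ∣ y)
    (hH : SameType (p * n) (p * y, x₂, x₃) (x', y', z')) : False := by
  by_cases h17 : 17 ≤ p
  · exact row_UZ1_seventeen p n y x₂ x₃ x' y' z' hp h17 hpn hn hodd hs hx₂ hx₃ hs' hx' hy' hz' hy hH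
  · have h16 : p ≤ 16 := by omega
    have h13' : p = 13 := by
      interval_cases p
      · rfl
      all_goals exact absurd hp (by norm_num)
    subst h13'
    exact row_UZ1_thirteen n y x₂ x₃ x' y' z' hpn hn hodd hs hx₂ hx₃ hs' hx' hy' hz' hy hH

/-! ## The `3 ∤ n` corollaries of the `p = 5` and `p = 7` residues (as used in `tables/KR-FREE.md` §7) -/

/-- `tables/KR-FREE.md` §7, first bullet: at `p = 5` the (Z3, Z1) row forces an entry `±m/3`, i.e. `3 ∣ n`;
so for `3 ∤ n` the pattern (Z3, Z1) is impossible at `p = 5` as well. -/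
theorem row_Z3Z1_five_not3 (n a b c y x₂ x₃ : ℕ) (h5n : ¬ 5 ∣ n) (hn : 0 < n) (hodd : Odd n) (h3 : ¬ 3 ∣ n)
    (hs : 5 * n ∣ 5 * y + x₂ + x₃) (hx₂ : ¬ 5 ∣ x₂) (hx₃ : ¬ 5 ∣ x₃) (hy : ¬ n ∣ y)
    (hH : SameType (5 * n) (5 * a, 5 * b, 5 * c) (5 * y, x₂, x₃)) : False := by
  have h := row_Z3Z1_five n a b c y x₂ x₃ h5n hn hodd hs hx₂ hx₃ hy hH
  exact h3 ⟨Nat.gcd y n, h.1.symm⟩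

/-- `tables/KR-FREE.md` §7, second bullet: at `p = 7` the (Z1, Z1) row gives `n/g ∈ {3, 5}`, `g = gcd(ȳ − ȳ′, n)`;
for `3 ∤ n` only `n/g = 5` remains (the case of PROPOSITION L7(c)). -/
theorem row_Z1Z1_seven_not3 (n y x₂ x₃ y' x₂' x₃' : ℕ) (h7n : ¬ 7 ∣ n) (hn : 0 < n) (hodd : Odd n) (h3 : ¬ 3 ∣ n)
    (hs : 7 * n ∣ 7 * y + x₂ + x₃) (hx₂ : ¬ 7 ∣ x₂) (hx₃ : ¬ 7 ∣ x₃)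
    (hs' : 7 * n ∣ 7 * y' + x₂' + x₃') (hx₂' : ¬ 7 ∣ x₂') (hx₃' : ¬ 7 ∣ x₃')
    (hyy' : ¬ y ≡ y' [MOD n])
    (hH : SameType (7 * n) (7 * y, x₂, x₃) (7 * y', x₂', x₃')) :
    n / Nat.gcd (y + (n - 1) * y') n = 5 := by
  rcases row_Z1Z1_seven n y x₂ x₃ y' x₂' x₃' h7n hn hodd hs hx₂ hx₃ hs' hx₂' hx₃' hyy' hH with h | h
  · exfalso
    apply h3
    refine ⟨Nat.gcd (y + (n - 1) * y') n, ?_⟩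
    have hd := Nat.div_mul_cancel (Nat.gcd_dvd_right (y + (n - 1) * y') n)
    rw [h] at hd
    omega
  · exact h

/-! ## Kernel instances and non-vacuity at the excluded primes

The hypotheses of `row_UZ1_thirteen` other than the prime being 13 are realised at `p = 5`: at `m = 15`
(`T = (5·1, 1, 9)`, `T′ = (1, 1, 13)`, the instantiated example of `TheoremLRows.lean`; `n = 3`, `g = 1`) and at `m = 45`
with `g = 3` (`T = (5·3, 3, 27)`, `T′ = (3, 3, 39)`, below) — in both `n = 3g`, the conclusion of `row_UZ1_three_g`, holds,
so the contradiction genuinely uses `p = 13` (through `k₁ ∈ {4, 8} = 6 ∓ 2`), not only `n = 3g`.  (At `p = 7` and `p = 11`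
the pattern (U, Z1) does not occur at all — PROPOSITION L7(a) and the `p = 11` refinement, not formalised here; a search at
`m ∈ {21, 63, 105, 33, 39}` finds none.) -/

example : SameType (5 * 9) (5 * 3, 3, 27) (3, 3, 39) :=
  sameType_of_fin (by norm_num) (by decide)

example : ¬ 9 ∣ 3 ∧ 9 = 3 * Nat.gcd 3 9 := by decide

/-- the value invariance `⟨13̄⁻¹t̄ · ȳ⟩_n = ⟨t̄ȳ⟩_n` at n = 9, g = 3, y = 3: 13⁻¹ ≡ 7 (mod 9); t = 2 ↦ 13̄⁻¹·2 = 14 ≡ 5 -/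
example : 13 * 7 % 9 = 1 ∧ 2 * 3 % 9 = 6 ∧ 5 * 3 % 9 = 6 ∧ 2 * 9 * (13 * 6 / 9) = 24 * 6 := by decide

end HodgeFermat.KRFree.TheoremL
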